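import Summits.CriticalPhenomena.SAWScalingLimit.Theses.SAWLoopFugacityFlow
import Summits.CriticalPhenomena.SAWScalingLimit.Theorems.SAWLoopFugacityFlowSimpleSubseqLimitsLineGlue
import Summits.CriticalPhenomena.SAWScalingLimit.Theorems.SAWLoopFugacityFlowSimpleSubseqLimitsStubRangeIsArc
import Summits.CriticalPhenomena.SAWScalingLimit.Theorems.SimpleSubseqLimits.Negative.SimpleSubseqLimitsNecessary
import Literature.Probability.RandomPlanarGeometry.LoewnerRegularCurves

/-!
# Line `marked-point-revisit` — skeleton for the crux `SimpleSubseqLimits` (stmt-CriticalPhenomena-4982),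
second lead (prover-line-stmt-CriticalPhenomena-4982-1), cycle 1, RESHAPE v2: the lattice input retyped
from a KISS bound to a SHADOWING bound

Crux (route decl `Summit.CriticalPhenomena.SAWScalingLimit.Theses.SAWLoopFugacityFlow.SimpleSubseqLimits`,
shared verbatim by SAWSteinDefect / SAWTensorRG / SAWFrontierHomotopy): every subsequential weak
limit `ν` of the critical `δℤ²` SAW laws in a Dobrushin domain `(D; a, b)` is carried by SIMPLE chords
from `a` to `b` in `cl D` meeting `∂D` only at `a, b`.

WHY THE RESHAPE.  The first lead's residual `NoTouchAt` (and its vertex form `LatticeNoTouch` of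
reshape v1) bounds the probability of an `ε`-KISS: the future returning `ε`-close to SOME point of a
macroscopic marked stretch of the past.  A kiss bound is true (summit-implied) but cannot be fed by
the only kind of lattice input anybody hopes to prove at `n = 0` — a Kemppainen–Smirnov-type
"unforced approach costs a constant factor `q < 1` per annulus" bound: a union bound over the
`≍ ε^{-4/3}` lattice boxes of the marked stretch needs a conditional approach probability
`≤ ε^{Δ}` with `Δ > 4/3` (heuristically the truth is `Δ = x₄ − x₂ = 35/12 − 2/3 = 9/4`, a
quantitative two-sided non-intersection exponent), while `q` per annulus of aspect `C` only gives
`Δ = log(1/q)/log C`.  An `ε`-SHADOWING of an `η`-stretch (travelling ALONG the own past at distance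
`< ε` through displacement `η`) instead forces `≍ η/ε` successive approaches, each costing `q`, so its
probability `q^{c η/ε}` beats every polynomial entropy factor: the shadowing bound IS derivable from a
`q`-per-annulus input by chaining (this is the sibling line `past-shadowing-costs-halves`, whose
typed intermediate statement `ShadowDecayAt` is adopted here VERBATIM).  And given SHAPE (arc range,
LANDED by the first lead: `ArcRangeGlue.stub_rangeIsArc`, p91256) a shadowing bound suffices: a
non-simple class with arc range RETRACES, i.e. shadows its past (`strictGrowth_of_not_shadows` +
the argmax lemma, kernel-checked in the sibling skeleton; here `stub_shadowGlue`).  So the ORDER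
residual of this line becomes `ShadowDecayAt` — weaker than `NoTouchAt` (kiss-free ⇒ shadow-free),
still necessary given `EventualTight` (nested closed thickenings of a shadowing shrink to an exact
retrace, excluded by simplicity), an unconditional probability of the laws the crux quantifies over
(immune to interior lattice roots AS A STATEMENT), and shared with the sibling line, whose stubs
`stub_nearReturnBound → stub_shadowChain → stub_rootReduction` are exactly a programme for proving it.

STATE.  SHAPE and the route plumbing are LANDED (first lead): `Glue.avoidanceAgree_of_routeItems`
(p86315), `ArcRangeGlue.stub_rangeIsArc` (p91256 + nine helper files), `Negative.ae_carrier_of_isSLELaw`,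
free clauses `Negative.ae_source_target_range_of_weakLimitAlong` (p74405).  Reshape v1 of this seat
(`stub_latticeNoTouch` + `stub_polylineTransfer`, registered 10:40Z) is superseded by this file; the
polyline transfer stays true and, if landed, documents `LatticeNoTouch → NoTouchAt`.

Registered stubs of v2 (the only sorries):
* `stub_shadowDecay`   : `IsEndpointApprox D a b → ShadowDecayAt D a b`            (lattice INPUT, OPEN)
* `stub_shadowPassage` : `ShadowDecayAt D a b → IsSubseqLimit D a b s ν → ν (shadowEvent η ρ) = 0`
                          (portmanteau on the OPEN thickened events, M, provable now)
* `stub_shadowGlue`    : arc range ∧ no shadowing ⇒ simple, one class at a time (deterministic; proof =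
                          the sibling skeleton's `mem_simple_of_arc_of_notMem_shadowEvent`, to be landed)
-/

noncomputable section

open MeasureTheory Filter Topology Set Metric Function
open Literature.Probability.RandomPlanarGeometry Literature.Probability.LatticeModels
open scoped ENNReal NNReal BoundedContinuousFunction unitInterval

namespace Summit.CriticalPhenomena.SAWScalingLimit.Cruxes.SimpleSubseqLimits.MarkedPointRevisit

open Summit.CriticalPhenomena.SAWScalingLimit.Theses.SAWLoopFugacityFlow
  (SimpleSubseqLimits AvoidanceLimit AvoidancePassage SLEAvoidanceValue SLECarrier)
open Summit.CriticalPhenomena.SAWScalingLimit.Theorems.SimpleSubseqLimits.MarkedPointRevisit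
open Summit.CriticalPhenomena.SAWScalingLimit.Theorems.SimpleSubseqLimits.MarkedPointRevisit.Glue
  (IsSubseqLimit HasArcRange avoidanceAgree_of_routeItems)

/-! ## Vocabulary (VERBATIM the sibling skeleton `Lines/past-shadowing-costs-halves.lean`, §1) -/

/-- `γ` **`(η, ρ)`-shadows its own past**: after some time `s₀` it travels through a stretch
`[t, t']` of displacement `≥ η` every point of which was already visited before `s₀` at a point at
distance `≥ ρ` from `γ s₀` ("travelling along the own past outside the `ρ`-ball at the tip").
[folklore] -/
def Shadows (γ : Curve ℂ) (η ρ : ℝ) : Prop :=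
  ∃ s₀ t t' : I, s₀ ≤ t ∧ t ≤ t' ∧ η ≤ dist (γ t) (γ t') ∧
    ∀ u : I, t ≤ u → u ≤ t' → γ u ∈ γ '' {v : I | v ≤ s₀ ∧ ρ ≤ dist (γ v) (γ s₀)}

/-- The event "some representative `(η, ρ)`-shadows its own past" on curve classes. [folklore] -/
def shadowEvent (η ρ : ℝ) : Set (CurveClass ℂ) :=
  {c | ∃ γ : Curve ℂ, CurveClass.mk γ = c ∧ Shadows γ η ρ}

/-- Lattice-visible **`ε`-near shadowing**: after `s₀`, a stretch of displacement `> η` stays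
within (open) distance `ε` of past points at distance `> ρ` from `γ s₀` (strict inequalities: an
OPEN event). [folklore] -/
def NearShadows (γ : Curve ℂ) (η ρ ε : ℝ) : Prop :=
  ∃ s₀ t t' : I, s₀ ≤ t ∧ t ≤ t' ∧ η < dist (γ t) (γ t') ∧
    ∀ u : I, t ≤ u → u ≤ t' → ∃ v : I, v ≤ s₀ ∧ ρ < dist (γ v) (γ s₀) ∧ dist (γ u) (γ v) < ε

/-- The event "some representative `ε`-nearly `(η, ρ)`-shadows its own past". [folklore] -/
def nearShadowEvent (η ρ ε : ℝ) : Set (CurveClass ℂ) :=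
  {c | ∃ γ : Curve ℂ, CurveClass.mk γ = c ∧ NearShadows γ η ρ ε}

/-- **Discrete shadow decay at `(D; a_δ, b_δ)`** (the line's ONE lattice input, sibling line's
`ShadowDecayAt` verbatim): for all thresholds `η, ρ` and every target `θ` there is a width `ε > 0`
(depending on `D`: a domain with an `η`-long corridor of width `< ε` forces near-shadowing, so NO
domain-uniform version is true) such that for all small meshes the critical SAW `ε`-nearly shadows an
`η`-stretch of its `ρ`-far past with probability `≤ θ`.  An unconditional probability of an OPEN event
of the curve class of the walk; an `x_c`-statement (false for `x > x_c`); implied by the summit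
conjecture and necessary given `EventualTight`. [folklore] -/
def ShadowDecayAt (D : DobrushinDomain) (a b : ℝ → Site 2) : Prop :=
  ∀ η ρ θ : ℝ, 0 < η → 0 < ρ → 0 < θ → ∃ ε : ℝ, 0 < ε ∧
    ∀ᶠ δ in 𝓝[>] (0 : ℝ),
      SAW.law D.carrier δ (a δ) (b δ) {γ | γ.curve ∈ nearShadowEvent η ρ ε} ≤ ENNReal.ofReal θ

/-! ## The registered stubs -/

/-- **LATTICE INPUT (OPEN — the crux's order content as a shadowing bound)**: for every Dobrushin
domain and endpoint approximation, `ShadowDecayAt D a b`.  No technique in print at `n = 0`; the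
sibling line `past-shadowing-costs-halves` derives it on boundary-rooted data from a `½`-per-annulus
near-return bound by a stopping-time chain (its stubs 2–4). -/
theorem stub_shadowDecay :
    ∀ (D : DobrushinDomain) (a b : ℝ → Site 2), SAW.IsEndpointApprox D a b → ShadowDecayAt D a b := by
  sorry

/-- **LIMIT PASSAGE (M, provable now)**: shadow decay at `(D; a_δ, b_δ)` + weak convergence along
`s n → 0⁺` ⇒ the limit gives mass `0` to every shadow event.  `shadowEvent η ρ ⊆ nearShadowEvent η' ρ' ε`
for `η' < η`, `ρ' < ρ` and every `ε > 0`; `nearShadowEvent` is OPEN in `CurveClass ℂ` (strict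
inequalities; compactness of `[t, t']` gives finitely many past times `v` serving all `u`, hence
uniform slack; reparametrisation invariance; `CurveClass.mk` is an open quotient map for the
pseudo-distance — same device as the landed `Passage.isOpen_nearRevisitEvent`); honesty of the laws
along `s n` and the open-set portmanteau give `ν(G) ≤ liminfₙ P_{s n}(G) ≤ limsup_{δ→0⁺} P_δ(G)`
(landed `Passage.measure_image_mk_le_limsup_law`), and `ShadowDecayAt` makes the right side `≤ θ`
for every `θ > 0`. -/
theorem stub_shadowPassage :
    ∀ (D : DobrushinDomain) (a b : ℝ → Site 2) (s : ℕ → ℝ) (ν : Measure (CurveClass ℂ)),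
      ShadowDecayAt D a b → IsSubseqLimit D a b s ν →
        ∀ η ρ : ℝ, 0 < η → 0 < ρ → ν (shadowEvent η ρ) = 0 := by
  sorry

/-- **SHAPE + ORDER ⇒ simple, one class at a time (deterministic; kernel-checked in the sibling
skeleton as `mem_simple_of_arc_of_notMem_shadowEvent`, ideator 3's argmax lemma + light
representatives + strict range growth)**: a class whose range is a simple arc with the same endpoints
and which lies in no shadow event `(1/(k+1), 1/(k+1))` is simple. -/
theorem stub_shadowGlue :
    ∀ (c : CurveClass ℂ) (e : C(I, ℂ)), Injective e → range e = c.range → e 0 = c.source →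
      e 1 = c.target → (∀ k : ℕ, c ∉ shadowEvent (1 / ((k : ℝ) + 1)) (1 / ((k : ℝ) + 1))) →
        c ∈ CurveClass.simple := by
  sorry

/-! ## Composition (kernel-checked modulo the stubs) -/

/-- `SLECarrier` (route item stmt-CriticalPhenomena-4985) from the tree's theorems. -/
theorem sleCarrier : SLECarrier := by
  intro D μ hμ
  haveI : Fact Literature.Probability.Process.isProjectiveLimit_preWienerMeasure :=
    ⟨isProjectiveLimit_preWienerMeasure_holds⟩
  exact ⟨hμ.isProbabilityMeasure,
    Summit.CriticalPhenomena.SAWScalingLimit.Theorems.SimpleSubseqLimits.Negative.ae_carrier_of_isSLELaw hμ⟩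

/-- **The crux BY NAME** from the landed SHAPE (`ArcRangeGlue.stub_rangeIsArc`, fed by
`Glue.avoidanceAgree_of_routeItems` and `sleCarrier`), the free clauses, the three registered stubs,
and the route's avoidance items `AvoidanceLimit` (stmt-10649, open rank-2 crux), `AvoidancePassage`
(stmt-4984), `SLEAvoidanceValue` (stmt-10651). -/
theorem SimpleSubseqLimits_of (hA : AvoidanceLimit) (hP : AvoidancePassage) (hV : SLEAvoidanceValue) :
    SimpleSubseqLimits := by
  intro D a b hab s ν hs hν hlim
  haveI := hν
  have hsub : IsSubseqLimit D a b s ν := ⟨hs, hν, hlim⟩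
  have hfree :=
    Summit.CriticalPhenomena.SAWScalingLimit.Theorems.SimpleSubseqLimits.Negative.ae_source_target_range_of_weakLimitAlong
      (ν := ν) hab hs hlim
  obtain ⟨μ, hμ, hagree⟩ := avoidanceAgree_of_routeItems hA hP hV hab hsub
  obtain ⟨hμP, hμcar⟩ := sleCarrier D μ hμ
  have hR := ArcRangeGlue.stub_rangeIsArc D ν μ hν hμP hfree hμcar hagree
  have hns : ∀ k : ℕ, ∀ᵐ c ∂ν, c ∉ shadowEvent (1 / ((k : ℝ) + 1)) (1 / ((k : ℝ) + 1)) :=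
    fun k => measure_eq_zero_iff_ae_notMem.1
      (stub_shadowPassage D a b s ν (stub_shadowDecay D a b hab) hsub _ _ (by positivity)
        (by positivity))
  rw [← ae_all_iff] at hns
  filter_upwards [hR, hfree, hns] with c hc hf hn
  obtain ⟨c', hc's, h0', h1', hcl, hfr, hrange⟩ := hc
  obtain ⟨γ, hγs, hγc'⟩ := hc's
  obtain ⟨hsrc, htgt, -⟩ := hf
  have hsimple : c ∈ CurveClass.simple := by
    refine stub_shadowGlue c γ.toContinuousMap hγs ?_ ?_ ?_ hn
    · show Set.range γ = c.range
      rw [← hrange, ← hγc']; rfl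
    · show γ 0 = c.source
      rw [hsrc, ← h0', ← hγc']; rfl
    · show γ 1 = c.target
      rw [htgt, ← h1', ← hγc']; rfl
  exact ⟨hsimple, hsrc, htgt, hrange ▸ hcl, hrange ▸ hfr⟩

end Summit.CriticalPhenomena.SAWScalingLimit.Cruxes.SimpleSubseqLimits.MarkedPointRevisit

end
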